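import Summits.AtomisticToContinuum.Crystallization.Theorems.FrustratedLawDichotomyTwoShellRigidityGluing

/-!
# FrustratedLawDichotomy · two-shell rigidity — the PLACEMENT STEP of the frame assembly (mirror branch excluded by a non-contact)

Theses-free toolkit (pure Mathlib) for `FrameAssemblyAt K c` (lens-5 g30, `FrustratedLawDichotomyTwoShellRigidityCells`), the last
open piece of `R = CoarseCappedRigidity K θ` after `Extraction` (p820807), `TetraCellAt 11` (p821511), `OctaCellAt 18` (p822087).
One step of the sequential placement, stated on GRAM DATA ONLY (so that the pattern walks are rational bookkeeping):

`placement_step`: a candidate global isometry `A` already fits the anchors `z₀, z₁` (unit, `⟪z₀,z₁⟫² ≤ 1/4`) and a witness `y` within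
`E·θ`; a cell isometry `A'` fits the anchors and the new vertex `x` within `c·θ`; `x = p z₀ + q z₁ + r n` in-plane coefficients `p, q`
(`p + κq = ⟪x,z₀⟫`, `κp + q = ⟪x,z₁⟫`), `L ≥ |p| + |q| + 3`; the MIRROR image of `x` in the anchor plane lies within `3/5` of `y`
(`2 − 2⟪x,y⟫ + 4(⟪x,y⟫ − p⟪y,z₀⟫ − q⟪y,z₁⟫) ≤ 9/25`, pure Gram data), the data points `X, Y` are `≥ 1` apart (the non-contact clause),
and `(c + L(E+c) + E)·θ < 2/5` ⟹ `A` fits `x` within `(c + L(E+c))·θ`.  (Normalised scale `d = 1`; the mirror branch of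
`isometry_transfer_point` would put `X` within `< 1` of `Y`.)  No `sorry`, no defs.
-/

noncomputable section

namespace Summit.AtomisticToContinuum.Crystallization.Theorems.FrustratedLawDichotomyTwoShellRigidityPlacement

open Summit.AtomisticToContinuum.Crystallization.Theorems.FrustratedLawDichotomyTwoShellRigidityFrames
open Summit.AtomisticToContinuum.Crystallization.Theorems.FrustratedLawDichotomyTwoShellRigidityGluing
open scoped RealInnerProductSpace

variable {V : Type*} [NormedAddCommGroup V] [InnerProductSpace ℝ V]

/-- In-plane coefficients: if `n` is a unit normal of the unit anchors `z₀, z₁` (`⟪z₀,z₁⟫ = κ`, `κ² ≤ 1/4`) and `p + κq = ⟪x,z₀⟫`,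
`κp + q = ⟪x,z₁⟫`, then `x = p z₀ + q z₁ + ⟪x,n⟫ n` (dimension three). [folklore] -/
theorem inplane_decomposition [FiniteDimensional ℝ V] (hV : Module.finrank ℝ V = 3) {z₀ z₁ n x : V} {κ p q : ℝ}
    (hz0 : ‖z₀‖ = 1) (hz1 : ‖z₁‖ = 1) (hκ : ⟪z₀, z₁⟫ = κ) (hκ2 : κ ^ 2 ≤ 1 / 4) (hn : ‖n‖ = 1) (hn0 : ⟪z₀, n⟫ = 0)
    (hn1 : ⟪z₁, n⟫ = 0) (hp : p + κ * q = ⟪x, z₀⟫) (hq : κ * p + q = ⟪x, z₁⟫) :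
    x = p • z₀ + q • z₁ + ⟪x, n⟫ • n := by
  -- Gram–Schmidt of the anchors: `z₀ = e₀`, `z₁ = κ e₀ + γ e₁`, `n = e₂`
  obtain ⟨e₀, e₁, e₂, κ', γ, δ, ε, ζ, he0, he1, he2, he01, he02, he12, r0, r1, r2, hγ, hζ⟩ := gramSchmidt_triple hV z₀ z₁ n
  have hE := inner_frame he0 he1 he2 he01 he02 he12
  have hEn := norm_sq_frame he0 he1 he2 he01 he02 he12
  rw [hz0, one_smul] at r0
  have z03 : z₀ = (1 : ℝ) • e₀ + (0 : ℝ) • e₁ + (0 : ℝ) • e₂ := by rw [r0]; module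
  have z13 : z₁ = κ' • e₀ + γ • e₁ + (0 : ℝ) • e₂ := by rw [r1]; module
  have q1 : κ' = κ := by
    have h := hE 1 0 0 κ' γ 0
    rw [← z03, ← z13, hκ] at h
    linarith only [h]
  have q2 : κ ^ 2 + γ ^ 2 = 1 := by
    have h := hEn κ' γ 0
    rw [← z13, hz1, q1] at h
    linarith only [h]
  have q3 : δ = 0 := by
    have h := hE 1 0 0 δ ε ζ
    rw [← z03, ← r2, hn0] at h
    linarith only [h]
  have hγ1 : 866 / 1000 ≤ γ := le_of_sq_le_sq_nonneg hγ (by norm_num) (by norm_num; linarith only [q2, hκ2])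
  have q4 : ε = 0 := by
    have h := hE κ' γ 0 δ ε ζ
    rw [← z13, ← r2, hn1, q3] at h
    have : γ * ε = 0 := by linarith only [h]
    rcases mul_eq_zero.1 this with h' | h'
    · exact absurd h' (by linarith only [hγ1])
    · exact h'
  have q5 : ζ = 1 := by
    have h := hEn δ ε ζ
    rw [← r2, hn, q3, q4] at h
    have h2 : ζ ^ 2 = 1 ^ 2 := by linarith only [h]
    exact (sq_eq_sq₀ hζ zero_le_one).1 h2
  rw [q3, q4, q5, zero_smul, zero_smul, zero_add, zero_add, one_smul] at r2
  rw [q1] at z13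
  -- coordinates of `x`
  have hx := frame_expansion hV he0 he1 he2 he01 he02 he12 x
  have c0 : ⟪x, e₀⟫ = p + κ * q := by rw [← r0, hp]
  have c1 : γ * ⟪x, e₁⟫ = γ ^ 2 * q := by
    have h : ⟪x, z₁⟫ = κ * ⟪x, e₀⟫ + γ * ⟪x, e₁⟫ := by
      rw [z13, inner_add_right, inner_add_right, real_inner_smul_right, real_inner_smul_right, real_inner_smul_right]; ring
    rw [← hq, c0] at h
    have hg : γ ^ 2 = 1 - κ ^ 2 := by linarith only [q2]
    rw [hg]; linarith only [h]
  have c1' : ⟪x, e₁⟫ = γ * q := by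
    have hγ0 : γ ≠ 0 := by linarith only [hγ1]
    have := c1
    field_simp at this ⊢
    linarith only [this]
  rw [c0, c1'] at hx
  rw [r2, r0, z13]
  obtain ⟨ρ, hρ⟩ : ∃ ρ : ℝ, ⟪x, e₂⟫ = ρ := ⟨_, rfl⟩
  rw [hρ] at hx ⊢
  rw [hx]
  module

/-- **The placement step** (scale `d = 1`).  See the module docstring. [folklore] -/
theorem placement_step [FiniteDimensional ℝ V] (hV : Module.finrank ℝ V = 3) (A A' : V →ₗᵢ[ℝ] V)
    {z₀ z₁ x y X Y P₀ P₁ : V} {κ p q L E c θ : ℝ} (hz0 : ‖z₀‖ = 1) (hz1 : ‖z₁‖ = 1) (hxu : ‖x‖ = 1) (hyu : ‖y‖ = 1)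
    (hκ : ⟪z₀, z₁⟫ = κ) (hκ2 : κ ^ 2 ≤ 1 / 4) (hp : p + κ * q = ⟪x, z₀⟫) (hq : κ * p + q = ⟪x, z₁⟫)
    (hL : |p| + |q| + 3 ≤ L) (hmirror : 2 - 2 * ⟪x, y⟫ + 4 * (⟪x, y⟫ - p * ⟪y, z₀⟫ - q * ⟪y, z₁⟫) ≤ 9 / 25)
    (hθ : 0 ≤ θ) (hE : 0 ≤ E) (hc : 0 ≤ c) (hsmall : (c + L * (E + c) + E) * θ < 2 / 5)
    (hP0 : ‖P₀ - A z₀‖ ≤ E * θ) (hP1 : ‖P₁ - A z₁‖ ≤ E * θ) (hY : ‖Y - A y‖ ≤ E * θ)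
    (hP0' : ‖P₀ - A' z₀‖ ≤ c * θ) (hP1' : ‖P₁ - A' z₁‖ ≤ c * θ) (hX : ‖X - A' x‖ ≤ c * θ) (hXY : 1 ≤ ‖X - Y‖) :
    ‖X - A x‖ ≤ (c + L * (E + c)) * θ := by
  -- a unit normal and the decomposition of `x`
  obtain ⟨n, hn, hn0', hn1'⟩ := exists_unit_orthogonal_two hV z₀ z₁
  have hn0 : ⟪z₀, n⟫ = 0 := by rw [real_inner_comm, hn0']
  have hn1 : ⟪z₁, n⟫ = 0 := by rw [real_inner_comm, hn1']
  have hxdec := inplane_decomposition hV hz0 hz1 hκ hκ2 hn hn0 hn1 hp hq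
  obtain ⟨r, hr⟩ : ∃ r : ℝ, ⟪x, n⟫ = r := ⟨_, rfl⟩
  rw [hr] at hxdec
  -- the two isometries agree on the anchors up to `η = (E + c) θ`
  have hL3 : 3 ≤ L := by linarith only [hL, abs_nonneg p, abs_nonneg q]
  have hEc : 0 ≤ (E + c) * θ := by positivity
  have hη : (E + c) * θ ≤ 1 / 2 := by nlinarith only [hsmall, hL3, hEc, hE, hc, hθ]
  have ha0 : ‖A z₀ - A' z₀‖ ≤ (E + c) * θ := by
    have h : A z₀ - A' z₀ = (P₀ - A' z₀) - (P₀ - A z₀) := by abel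
    rw [h]; refine (norm_sub_le _ _).trans ?_; linarith only [hP0, hP0']
  have ha1 : ‖A z₁ - A' z₁‖ ≤ (E + c) * θ := by
    have h : A z₁ - A' z₁ = (P₁ - A' z₁) - (P₁ - A z₁) := by abel
    rw [h]; refine (norm_sub_le _ _).trans ?_; linarith only [hP1, hP1']
  have hκsq : ⟪z₀, z₁⟫ ^ 2 ≤ 1 / 4 := by rw [hκ]; exact hκ2
  -- `|r| ≤ 1`, so the transfer constant is at most `L`
  have hr1 : |r| ≤ 1 := by
    have h := abs_real_inner_le_norm x n
    rw [hr, hxu, hn, one_mul] at h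
    exact h
  have hcoef : (|p| + |q| + 3 * |r|) * ((E + c) * θ) ≤ L * ((E + c) * θ) := by
    apply mul_le_mul_of_nonneg_right _ hEc
    linarith only [hL, hr1]
  rcases isometry_transfer_point hV A A' hz0 hz1 hκsq hn hn0 hn1 hη ha0 ha1 p q r with h | h
  · -- same orientation
    rw [← hxdec] at h
    have hsplit : X - A x = (X - A' x) + (A' x - A x) := by abel
    rw [hsplit]
    refine (norm_add_le _ _).trans ?_
    have := h.trans hcoef
    nlinarith only [hX, this]
  · -- mirror branch: `X` would be within `< 1` of `Y`
    exfalso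
    rw [← hxdec] at h
    have hm : ‖A (x - (2 * r) • n) - A y‖ ^ 2 ≤ 9 / 25 := by
      rw [← map_sub, A.norm_map, ← real_inner_self_eq_norm_sq]
      have hxy : ⟪x, y⟫ = p * ⟪y, z₀⟫ + q * ⟪y, z₁⟫ + r * ⟪y, n⟫ := by
        nth_rewrite 1 [hxdec]
        rw [inner_add_left, inner_add_left, real_inner_smul_left, real_inner_smul_left, real_inner_smul_left,
          real_inner_comm z₀ y, real_inner_comm z₁ y, real_inner_comm n y]
      have hxx : ⟪x, x⟫ = 1 := by rw [real_inner_self_eq_norm_sq, hxu, one_pow]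
      have hyy : ⟪y, y⟫ = 1 := by rw [real_inner_self_eq_norm_sq, hyu, one_pow]
      have hnn : ⟪n, n⟫ = 1 := by rw [real_inner_self_eq_norm_sq, hn, one_pow]
      have hxn : ⟪x, n⟫ = r := hr
      have h2 : ⟪x - (2 * r) • n - y, x - (2 * r) • n - y⟫ = 2 - 2 * ⟪x, y⟫ + 4 * (r * ⟪y, n⟫) := by
        simp only [inner_sub_left, inner_sub_right, real_inner_smul_left, real_inner_smul_right, hxx, hyy, hnn, hxn,
          real_inner_comm x y, real_inner_comm x n, real_inner_comm y n]
        ring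
      rw [h2]
      have h3 : r * ⟪y, n⟫ = ⟪x, y⟫ - p * ⟪y, z₀⟫ - q * ⟪y, z₁⟫ := by linarith only [hxy]
      rw [h3]
      exact hmirror
    have hm' : ‖A (x - (2 * r) • n) - A y‖ ≤ 3 / 5 :=
      (sq_le_sq₀ (norm_nonneg _) (by norm_num)).1 (hm.trans (by norm_num))
    have hXm : ‖X - A (x - (2 * r) • n)‖ ≤ c * θ + L * ((E + c) * θ) := by
      have hsplit : X - A (x - (2 * r) • n) = (X - A' x) + (A' x - A (x - (2 * r) • n)) := by abel
      rw [hsplit]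
      refine (norm_add_le _ _).trans ?_
      linarith only [hX, h.trans hcoef]
    have hXY' : ‖X - Y‖ < 1 := by
      have hsplit : X - Y = (X - A (x - (2 * r) • n)) + (A (x - (2 * r) • n) - A y) + (A y - Y) := by abel
      rw [hsplit]
      refine (norm_add₃_le).trans_lt ?_
      rw [← norm_neg (A y - Y), neg_sub]
      nlinarith only [hXm, hm', hY, hsmall]
    linarith only [hXY, hXY']

end Summit.AtomisticToContinuum.Crystallization.Theorems.FrustratedLawDichotomyTwoShellRigidityPlacement

end
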